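import Summits.AnomalousDissipation.AnomalousDissipation.Theorems.SawtoothPulseCascadeK1LocalisedCascadeTailFinal
import Summits.AnomalousDissipation.AnomalousDissipation.Theorems.SawtoothPulseCascadeConstructionRegular58

/-!
# K1loc′ MODULO THE START: the iterates exist, so only the two phase-4 numbers remain

Prover lane on the crux `K1LocalisedCascade` (stmt-AnomalousDissipation-19491), route `SawtoothPulseCascade`
(S-B/S-C assembly seat; the LEDGER ASSEMBLY of K1loc′).  The inviscid iterates `a_{j+1} = (a_j ∘ H_j) ∘ V_j`, `b_j = a_j ∘ H_j`,
`a_0 = datum` exist and are smooth (`exists_iterates`, by recursion; `…ConstructionRegular58`'s `Cascade.isSmooth_datum`, `Torus.IsSmooth.comp_shearMap`), so `…TailFinal.k1Localised_of_phase4` gives K1loc′ from a START HYPOTHESIS quantified over the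
iterates:
  **`k1Localised_of_start`**: if every admissible pair of iterate sequences admits phase-4 numbers `E₄, o₄` with
  `S₄(500000) + O₄(500000) ≤ E₄`, `√O₄(500000) ≤ o₄`, `E₄ + 0.2488·o₄ ≤ 0.348`, then `K1Localised P (γ² − 3)`
  (`γ = 8`, `0 < δ₀ ≤ 2⁻¹⁰⁰`, `(d, N₀, ρ_N) = (2, 1, 2)`).
No definitions; no statement about the crux itself. [cite: DEIJ2022, (1.2)–(1.3)] [problem: turb]
-/

-- `Summit.<Summit>.<Problem>`: single-conjunct summit, the duplicate namespace segment is deliberate.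
set_option linter.dupNamespace false

noncomputable section

namespace Summit.AnomalousDissipation.AnomalousDissipation.Theorems.SawtoothPulseCascade.K1Window

open MeasureTheory Set Filter Topology UnitAddTorus Function Complex Metric
open scoped Real ENNReal ContDiff
open Literature.Analysis Literature.Analysis.FunctionSpaces Literature.Analysis.FunctionSpaces.Torus Literature.Analysis.FluidPDE
open Literature.Analysis.FluidPDE.ShearStage
open Literature.Analysis.FluidPDE.SawtoothCascade Literature.Analysis.FluidPDE.SawtoothCascade.CascadeParams
open Summit.AnomalousDissipation.AnomalousDissipation.Theorems.SawtoothPulseCascade.K1Start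
open Summit.AnomalousDissipation.AnomalousDissipation.Theorems.SawtoothPulseCascade.K1Flat
open Summit.AnomalousDissipation.AnomalousDissipation.Theorems.SawtoothPulseCascade.K1Ledger.From

section Cascade

variable (P : CascadeParams)

/-- **The inviscid iterates exist and are smooth**: sequences `a, b` with `a_0 = datum`, `b_j = a_j ∘ H_j`, `a_{j+1} = b_j ∘ V_j`.
[folklore] -/
theorem exists_iterates (hδ₀ : 0 < P.δ₀) (hd : 0 < P.d) :
    ∃ a b : ℕ → UnitAddTorus (Fin 2) → ℝ, (∀ j, IsSmooth (a j)) ∧ a 0 = datum ∧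
      (∀ j, b j = a j ∘ shearMap 0 1 (amp ⟨P.U j, P.U_periodic j, P.contDiff_U (P.δ_pos hδ₀ hd j)⟩ P.γ)) ∧
      (∀ j, a (j + 1) = b j ∘ shearMap 1 0 (amp ⟨P.U j, P.U_periodic j, P.contDiff_U (P.δ_pos hδ₀ hd j)⟩ P.γ)) := by
  let Ψ : ℕ → ShearProfile := fun j => ⟨P.U j, P.U_periodic j, P.contDiff_U (P.δ_pos hδ₀ hd j)⟩
  let a : ℕ → UnitAddTorus (Fin 2) → ℝ := fun n => Nat.rec (motive := fun _ => UnitAddTorus (Fin 2) → ℝ) datum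
    (fun j aj => (aj ∘ shearMap 0 1 (amp (Ψ j) P.γ)) ∘ shearMap 1 0 (amp (Ψ j) P.γ)) n
  let b : ℕ → UnitAddTorus (Fin 2) → ℝ := fun j => a j ∘ shearMap 0 1 (amp (Ψ j) P.γ)
  have h0 : a 0 = datum := rfl
  have hb : ∀ j, b j = a j ∘ shearMap 0 1 (amp (Ψ j) P.γ) := fun j => rfl
  have hab : ∀ j, a (j + 1) = b j ∘ shearMap 1 0 (amp (Ψ j) P.γ) := fun j => rfl
  have has : ∀ j, IsSmooth (a j) := by
    intro j
    induction j with
    | zero => rw [h0]; exact Summit.AnomalousDissipation.AnomalousDissipation.Theorems.Cascade.isSmooth_datum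
    | succ j ih =>
      rw [hab, hb]
      exact ((ih.comp_shearMap _ _ _).comp_shearMap _ _ _)
  exact ⟨a, b, has, h0, hb, hab⟩

/-- **K1loc′ MODULO THE START** (see the file header). [cite: DEIJ2022, (1.2)–(1.3)] -/
theorem k1Localised_of_start (hγ : P.γ = 8) (hδ₀ : 0 < P.δ₀) (hδ₀' : P.δ₀ ≤ (2 : ℝ)⁻¹ ^ 100) (hd : P.d = 2) (hN₀ : P.N₀ = 1)
    (hρN : P.ρN = 2)
    (hstart : ∀ a b : ℕ → UnitAddTorus (Fin 2) → ℝ, (∀ j, IsSmooth (a j)) → a 0 = datum →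
      (∀ j, b j = a j ∘ shearMap 0 1 (amp ⟨P.U j, P.U_periodic j, P.contDiff_U (P.δ_pos hδ₀ (by rw [hd]; norm_num) j)⟩ P.γ)) →
      (∀ j, a (j + 1) = b j ∘ shearMap 1 0 (amp ⟨P.U j, P.U_periodic j, P.contDiff_U (P.δ_pos hδ₀ (by rw [hd]; norm_num) j)⟩ P.γ)) →
      ∃ E₄ o₄ : ℝ, 0 ≤ o₄ ∧
        ∑' k : Fin 2 → ℤ, (if |k 0| < ((500000 : ℕ) : ℤ) then (1 : ℝ) else 0) * ‖mFourierCoeff (fun x => (a 4 x : ℂ)) k‖ ^ 2 +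
          ∑' k : Fin 2 → ℤ, (if ((500000 : ℕ) : ℤ) ≤ |k 0| ∧ ((1 : ℕ) : ℤ) * |k 0| ≤ ((4 : ℕ) : ℤ) * |k 1| then (1 : ℝ) else 0) *
            ‖mFourierCoeff (fun x => (a 4 x : ℂ)) k‖ ^ 2 ≤ E₄ ∧
        Real.sqrt (∑' k : Fin 2 → ℤ, (if ((500000 : ℕ) : ℤ) ≤ |k 0| ∧ ((1 : ℕ) : ℤ) * |k 0| ≤ ((4 : ℕ) : ℤ) * |k 1| then (1 : ℝ) else 0) *
            ‖mFourierCoeff (fun x => (a 4 x : ℂ)) k‖ ^ 2) ≤ o₄ ∧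
        E₄ + 0.2488 * o₄ ≤ 0.348) :
    K1Localised P (P.γ ^ 2 - 3) := by
  obtain ⟨a, b, has, h0, hb, hab⟩ := exists_iterates P hδ₀ (by rw [hd]; norm_num)
  obtain ⟨E₄, o₄, ho₄, hE, ho, hbud⟩ := hstart a b has h0 hb hab
  exact k1Localised_of_phase4 P hγ hδ₀ hδ₀' hd hN₀ hρN a b has h0 hb hab ho₄ hE ho hbud

end Cascade

end Summit.AnomalousDissipation.AnomalousDissipation.Theorems.SawtoothPulseCascade.K1Window
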